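import Literature.NumberTheory.EllipticCurves.IwasawaAlgebraDivisibilityProofs
import HarnessLib

/-!
# Characteristic ideals: PROMOTION of a localized containment `(π₀^m)·A ⊆ char(X)` to `A ⊆ char(X)`
# when `X` has no `(π₀)`-primary part

Generic commutative algebra (everything PROVED, nothing assumed), the converse companion of the tree's
bridge `Literature.NumberTheory.EllipticCurves.Module.exists_pow_mul_mem_charIdeal_of_lengthAt_le`
(file `IwasawaAlgebraDivisibilityProofs`). Over a Noetherian UFD `R` (e.g. `Λ = ℤ_p⟦T⟧`), for a
finitely generated torsion module `X` and a prime element `π₀`: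

  if `length_{R_(π₀)} X_(π₀) = 0` (no `(π₀)`-primary part: for `R = Λ`, `π₀ = p` this is `μ(X) = 0`,
  for `π₀ = T = γ - 1` it is "`char(X)` prime to the augmentation ideal") then
  `(π₀ ^ m) · A ⊆ char(X)  ⟹  A ⊆ char(X)` for every ideal `A` and every `m`.

Proof: `char(X) = ∏_{ht 𝔭 = 1} 𝔭^{length X_𝔭}` is the principal ideal `(f)`, `f = ∏ π_𝔭^{n_𝔭}` over
the finite height-one support, each `π_𝔭` a prime element NOT associated to `π₀` (the support misses
`(π₀)` by hypothesis); so `f` is relatively prime to `π₀^m` and `f ∣ π₀^m a ⟹ f ∣ a`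
(Bourbaki AC VII §4.5; Washington §13.2: the structure of `char` as a product of height-one primes).

WHY (cell `run/shared/lean/pub/bsd-print-x9/`, plan g9 FINDING PIN-1 §5, 2026-08-28): on the Howard
road at a prime `p ∣ h_K` the PRINTED input is the LOCALIZED containment of Castella–Grossi–Lee–Skinner
2022 Thm. 4.1.3 — `char_Λ(𝒳_tors) ∣ (p^m)(T^n)·I(Λκ_∞)²`, i.e. `(p^m)(T^n)·I² ⊆ char_Λ(𝒳_tors)`
(`CastellaGrossiLeeSkinner2022.charIdeal_torsion_dvd_localized_of_thm413`; at Selmer corank one the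
`T`-part is absent, "Moreover" clause) — while the route items (`HowardContainment…Pinned`, the
`stub_depthPos_promotion` / «μ-part» stubs of the lines torsion-depth, torsion-depth-light(-ofprint),
torsion-depth-x10b) ask for the INTEGRAL containment `I² ⊆ char_Λ(𝒳_tors)`. This file is the exact
algebra of that PROMOTION: it isolates the open arithmetic input as the vanishing of ONE local length
of the torsion Iwasawa module — `μ(𝒳_tors) = 0` (and, off corank one, no `(γ-1)`-primary part) — and
nothing about Heegner modules. It proves no arithmetic; it does not touch the beyond-print status of
that `μ`-statement at small residual image (cell DOSSIER §41.12–41.13). BSD is not proved by any of this.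

* `Module.exists_charIdeal_eq_span_prod_pow` — `char(X) = (∏_{𝔭 ∈ t} π_𝔭^{n_𝔭})` with `t` the finite
  height-one support (`n_𝔭 = length X_𝔭 ≠ 0`), `π_𝔭` prime, `𝔭 = (π_𝔭)`.
* `Module.le_charIdeal_of_span_pow_mul_le` — **the promotion lemma** (statement above).
* `Module.le_charIdeal_of_span_pow_mul_span_pow_mul_le` — two prime elements at once
  (`(π₀^m)(π₁^n)·A ⊆ char ⟹ A ⊆ char` when both local lengths vanish).
* `IwasawaAlgebra.le_charIdeal_of_span_p_pow_mul_le`, `…_of_span_p_pow_mul_span_X_pow_mul_le` — the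
  cases `R = Λ = ℤ_[p]⟦T⟧`, `π₀ = p` (`μ = 0`), `π₁ = T`, in the literal shape of the cell's stubs
  (`Ideal.span {(p : Λ) ^ m} * Ideal.span {PowerSeries.X ^ n} * I ^ 2 ≤ char`).

* `Module.charIdeal_le_span_singleton_pow_of_le_lengthAt`, `Module.le_charIdeal_of_span_pow_mul_le_of_lengthAt_le`,
  `Module.sq_charIdeal_le_charIdeal_of_span_pow_mul_le_of_lengthAt_le_two_mul` (+ `Λ`-versions) —
  **promotion with a μ-INEQUALITY** (2026-08-28): `length X_(π₀) ≤ n`, `A ⊆ (π₀^n)`, `(π₀^m)·A ⊆ char(X)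
  ⟹ A ⊆ char(X)`; for `A = char(Y)²` only `μ(X) ≤ 2 μ(Y)` is needed — the SHARP μ-part of the Howard road
  (`μ(𝒳_tors) ≤ 2 μ(𝔖/ℋ_F)`, implied by Perrin-Riou's equality), strictly weaker than `μ(𝒳_tors) = 0`.

References: N. Bourbaki, *Algèbre commutative* VII §4.4–4.5 (structure of `char`, Prop. 10);
L. Washington, *Introduction to Cyclotomic Fields*, §13.2 (height-one primes of `Λ` are principal;
`μ` as the exponent of `(p)`); F. Castella, G. Grossi, J. Lee, C. Skinner, Invent. Math. 227 (2022)
Thm. 4.1.3 / Cor. 3.4.2 (the localized divisibility this promotes). Mathlib supplies: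
`IsRelPrime.prod_left`, `IsRelPrime.dvd_of_dvd_mul_left`, `Ideal.eq_span_singleton_of_height_eq_one`,
`Ideal.IsPrime.exists_mem_prime_of_ne_bot`, `finprod_mem_eq_prod_of_inter_mulSupport_eq`,
`PowerSeries.X_prime`.
-/

noncomputable section

namespace Literature.NumberTheory.EllipticCurves

namespace Module

section Promotion

variable {R : Type*} [CommRing R] [IsDomain R] [IsNoetherianRing R] [UniqueFactorizationMonoid R]
  {X : Type*} [AddCommGroup X] [_root_.Module R X]

/-- **`char(X)` as a principal ideal generated by a product of prime powers over the support.** For a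
finitely generated torsion module `X` over a Noetherian UFD there are a finite set `t` of height-one
primes and prime elements `π_𝔭` with `𝔭 = (π_𝔭)` and `length X_𝔭 ≠ 0` for `𝔭 ∈ t`, such that
`char(X) = (∏_{𝔭 ∈ t} π_𝔭 ^ length X_𝔭)` (Bourbaki AC VII §4.5; Washington §13.2: every height-one
prime of a UFD is principal; NSW (5.3.9)–(5.3.10) for `Λ`).
[cite: NeukirchSchmidtWingberg2008, Ch. V §3, (5.3.9)–(5.3.10) (char as a product of height-one prime powers)]
[cite: Washington1997, §13.2 (Λ is a UFD; char ideal = (∏ p^{μ_i} f_j^{n_j}))] -/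
theorem exists_charIdeal_eq_span_prod_pow [Module.Finite R X] (hX : Module.IsTorsion R X) :
    ∃ (t : Finset (PrimeSpectrum R)) (π : PrimeSpectrum R → R),
      (∀ 𝔭 ∈ t, 𝔭.asIdeal.height = 1 ∧ lengthAt R X 𝔭 ≠ 0 ∧ Prime (π 𝔭) ∧
        𝔭.asIdeal = Ideal.span {π 𝔭}) ∧
      charIdeal R X = Ideal.span {∏ 𝔭 ∈ t, π 𝔭 ^ (lengthAt R X 𝔭).toNat} := by
  classical
  -- one `s ≠ 0` kills the finitely generated torsion module `X`
  obtain ⟨s, hsann, hs0⟩ := Submodule.annihilator_top_inter_nonZeroDivisors hX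
  have hs : s ≠ 0 := nonZeroDivisors.ne_zero hs0
  have hsX : Module.IsTorsionBy R X s := fun x =>
    Submodule.mem_annihilator.mp hsann x Submodule.mem_top
  -- `char X` is a finite product over the height-one support `t`
  set F : PrimeSpectrum R → Ideal R := fun 𝔭 => 𝔭.asIdeal ^ (lengthAt R X 𝔭).toNat with hF
  have hfin := finite_heightOne_inter_mulSupport hs hsX
  set t : Finset (PrimeSpectrum R) := hfin.toFinset with ht
  have hchar : charIdeal R X = ∏ 𝔭 ∈ t, F 𝔭 := by
    unfold charIdeal
    refine finprod_mem_eq_prod_of_inter_mulSupport_eq F ?_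
    rw [ht, Set.Finite.coe_toFinset, Set.inter_assoc, Set.inter_self]
  -- every `𝔭 ∈ t` has height one, nonzero local length and contains `s`
  have hmem : ∀ 𝔭 ∈ t, 𝔭.asIdeal.height = 1 ∧ lengthAt R X 𝔭 ≠ 0 ∧ s ∈ 𝔭.asIdeal := by
    intro 𝔭 h𝔭
    rw [ht, Set.Finite.mem_toFinset] at h𝔭
    refine ⟨h𝔭.1, fun h0 => h𝔭.2 ?_, ?_⟩
    · simp [h0]
    · by_contra hns
      exact h𝔭.2 (by simp [lengthAt_eq_zero_of_isTorsionBy hsX 𝔭 hns])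
  -- hence is generated by a prime element
  have hgen : ∀ 𝔭 ∈ t, ∃ π : R, Prime π ∧ 𝔭.asIdeal = Ideal.span {π} := by
    intro 𝔭 h𝔭
    obtain ⟨h1, -, hs𝔭⟩ := hmem 𝔭 h𝔭
    have hne : 𝔭.asIdeal ≠ ⊥ := fun hbot => hs (by rwa [hbot, Ideal.mem_bot] at hs𝔭)
    obtain ⟨π, hπ𝔭, hπ⟩ := Ideal.IsPrime.exists_mem_prime_of_ne_bot 𝔭.isPrime hne
    exact ⟨π, hπ, Ideal.eq_span_singleton_of_height_eq_one h1 hπ𝔭 hπ⟩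
  choose! π hπ hπeq using hgen
  refine ⟨t, π, fun 𝔭 h𝔭 => ⟨(hmem 𝔭 h𝔭).1, (hmem 𝔭 h𝔭).2.1, hπ 𝔭 h𝔭, hπeq 𝔭 h𝔭⟩, ?_⟩
  rw [hchar, ← Ideal.prod_span_singleton]
  refine Finset.prod_congr rfl fun 𝔭 h𝔭 => ?_
  simp only [F]
  rw [hπeq 𝔭 h𝔭, Ideal.span_singleton_pow]

/-- **The promotion lemma.** Let `R` be a Noetherian UFD, `X` a finitely generated torsion
`R`-module and `π₀` a prime element such that the local length of `X` at the height-one prime `(π₀)`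
vanishes (no `(π₀)`-primary part; for `R = Λ`, `π₀ = p`: `μ(X) = 0`). Then for every ideal `A` and
every `m`, `(π₀ ^ m) · A ⊆ char(X)` implies `A ⊆ char(X)`: the generator `∏ π_𝔭^{n_𝔭}` of `char(X)`
involves only primes not associated to `π₀`, so it is relatively prime to `π₀ ^ m`, and
`f ∣ π₀^m a ⟹ f ∣ a` — the divisor calculus of characteristic ideals (Bourbaki AC VII §4.5; NSW Ch. V
§3 (5.3.9)–(5.3.10); Washington §13.2), read at one prime.
[cite: NeukirchSchmidtWingberg2008, Ch. V §3, (5.3.9)–(5.3.10)] [cite: Washington1997, §13.2] -/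
theorem le_charIdeal_of_span_pow_mul_le [Module.Finite R X] (hX : Module.IsTorsion R X)
    {π₀ : R} (hπ₀ : Prime π₀)
    (hμ : ∀ 𝔭 : PrimeSpectrum R, 𝔭.asIdeal = Ideal.span {π₀} → lengthAt R X 𝔭 = 0)
    {A : Ideal R} {m : ℕ} (h : Ideal.span {π₀ ^ m} * A ≤ charIdeal R X) :
    A ≤ charIdeal R X := by
  classical
  obtain ⟨t, π, ht, hchar⟩ := exists_charIdeal_eq_span_prod_pow hX
  -- the generator of `char X` is relatively prime to `π₀ ^ m`
  have hrel : IsRelPrime (∏ 𝔭 ∈ t, π 𝔭 ^ (lengthAt R X 𝔭).toNat) (π₀ ^ m) := by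
    refine IsRelPrime.prod_left fun 𝔭 h𝔭 => ?_
    obtain ⟨-, hlen, hπ, hπeq⟩ := ht 𝔭 h𝔭
    refine isRelPrime_pow_of_not_associated hπ hπ₀ (fun hass => hlen (hμ 𝔭 ?_)) _ _
    rw [hπeq]
    exact Ideal.span_singleton_eq_span_singleton.mpr hass
  intro a ha
  have hmem : π₀ ^ m * a ∈ charIdeal R X :=
    h (Ideal.mul_mem_mul (Ideal.mem_span_singleton_self _) ha)
  rw [hchar, Ideal.mem_span_singleton] at hmem ⊢
  exact hrel.dvd_of_dvd_mul_left hmem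

/-- **Promotion at two prime elements** (e.g. `p` and `T = γ - 1` in `Λ`): if the local lengths of
`X` at `(π₀)` and at `(π₁)` both vanish, then `(π₀ ^ m)(π₁ ^ n) · A ⊆ char(X)` implies `A ⊆ char(X)` (the previous lemma twice).
[cite: NeukirchSchmidtWingberg2008, Ch. V §3, (5.3.9)–(5.3.10)] [cite: Washington1997, §13.2] -/
theorem le_charIdeal_of_span_pow_mul_span_pow_mul_le [Module.Finite R X] (hX : Module.IsTorsion R X)
    {π₀ π₁ : R} (hπ₀ : Prime π₀) (hπ₁ : Prime π₁)
    (hμ₀ : ∀ 𝔭 : PrimeSpectrum R, 𝔭.asIdeal = Ideal.span {π₀} → lengthAt R X 𝔭 = 0)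
    (hμ₁ : ∀ 𝔭 : PrimeSpectrum R, 𝔭.asIdeal = Ideal.span {π₁} → lengthAt R X 𝔭 = 0)
    {A : Ideal R} {m n : ℕ}
    (h : Ideal.span {π₀ ^ m} * Ideal.span {π₁ ^ n} * A ≤ charIdeal R X) :
    A ≤ charIdeal R X := by
  rw [mul_assoc] at h
  exact le_charIdeal_of_span_pow_mul_le hX hπ₁ hμ₁ (le_charIdeal_of_span_pow_mul_le hX hπ₀ hμ₀ h)

/-- The same with the two prime powers packed in ONE generator `(π₀ ^ m * π₁ ^ n)` (the shape of the
cell's `stub_depthPos_localized…` statements).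
[cite: NeukirchSchmidtWingberg2008, Ch. V §3, (5.3.9)–(5.3.10)] [cite: Washington1997, §13.2] -/
theorem le_charIdeal_of_span_pow_mul_pow_mul_le [Module.Finite R X] (hX : Module.IsTorsion R X)
    {π₀ π₁ : R} (hπ₀ : Prime π₀) (hπ₁ : Prime π₁)
    (hμ₀ : ∀ 𝔭 : PrimeSpectrum R, 𝔭.asIdeal = Ideal.span {π₀} → lengthAt R X 𝔭 = 0)
    (hμ₁ : ∀ 𝔭 : PrimeSpectrum R, 𝔭.asIdeal = Ideal.span {π₁} → lengthAt R X 𝔭 = 0)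
    {A : Ideal R} {m n : ℕ}
    (h : Ideal.span {π₀ ^ m * π₁ ^ n} * A ≤ charIdeal R X) :
    A ≤ charIdeal R X := by
  rw [← Ideal.span_singleton_mul_span_singleton] at h
  exact le_charIdeal_of_span_pow_mul_span_pow_mul_le hX hπ₀ hπ₁ hμ₀ hμ₁ h

omit [UniqueFactorizationMonoid R] in
/-- **The exponent of `(π₀)` in `char(X)` as a containment**: for f.g. torsion `X` over a Noetherian
domain, `π₀` prime and `n ≤ length X_(π₀)`, `char(X) ⊆ (π₀ ^ n)` (the factor `(π₀)^{length X_(π₀)}` of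
`char(X)`; Washington §13.2). [cite: Washington1997, §13.2] [cite: NeukirchSchmidtWingberg2008, Ch. V §3, (5.3.9)–(5.3.10)] -/
theorem charIdeal_le_span_singleton_pow_of_le_lengthAt [Module.Finite R X] (hX : Module.IsTorsion R X)
    {π₀ : R} (hπ₀ : Prime π₀) (𝔭₀ : PrimeSpectrum R) (h𝔭₀ : 𝔭₀.asIdeal = Ideal.span {π₀}) {n : ℕ}
    (hn : (n : ℕ∞) ≤ lengthAt R X 𝔭₀) :
    charIdeal R X ≤ Ideal.span {π₀ ^ n} := by
  classical
  rcases Nat.eq_zero_or_pos n with rfl | hnpos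
  · rw [pow_zero, Ideal.span_singleton_one]; exact le_top
  -- one `s ≠ 0` kills `X`; `char X` is a finite product over the height-one support `t`
  obtain ⟨s, hsann, hs0⟩ := Submodule.annihilator_top_inter_nonZeroDivisors hX
  have hs : s ≠ 0 := nonZeroDivisors.ne_zero hs0
  have hsX : Module.IsTorsionBy R X s := fun x =>
    Submodule.mem_annihilator.mp hsann x Submodule.mem_top
  set F : PrimeSpectrum R → Ideal R := fun 𝔭 => 𝔭.asIdeal ^ (lengthAt R X 𝔭).toNat with hF
  have hfin := finite_heightOne_inter_mulSupport hs hsX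
  set t : Finset (PrimeSpectrum R) := hfin.toFinset with ht
  have hchar : charIdeal R X = ∏ 𝔭 ∈ t, F 𝔭 := by
    unfold charIdeal
    refine finprod_mem_eq_prod_of_inter_mulSupport_eq F ?_
    rw [ht, Set.Finite.coe_toFinset, Set.inter_assoc, Set.inter_self]
  -- `(π₀)` has height one, finite length `k ≥ n ≥ 1`, hence lies in the support
  have h1 : 𝔭₀.asIdeal.height = 1 := by
    rw [h𝔭₀]
    exact Ideal.height_span_singleton_eq_one_of_mem_nonZeroDivisors
      (mem_nonZeroDivisors_of_ne_zero hπ₀.ne_zero) hπ₀.not_unit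
  have hfinlen : lengthAt R X 𝔭₀ ≠ ⊤ := lengthAt_ne_top_of_isTorsionBy hs hsX 𝔭₀ h1.le
  have hnk : n ≤ (lengthAt R X 𝔭₀).toNat := by
    rw [← ENat.coe_toNat hfinlen, Nat.cast_le] at hn
    exact hn
  have hk : (lengthAt R X 𝔭₀).toNat ≠ 0 := by omega
  have hne_top : 𝔭₀.asIdeal ≠ ⊤ := 𝔭₀.isPrime.ne_top
  have hmem : 𝔭₀ ∈ t := by
    rw [ht, Set.Finite.mem_toFinset]
    refine ⟨h1, ?_⟩
    rw [Function.mem_mulSupport]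
    intro hF1
    have hle : 𝔭₀.asIdeal ^ (lengthAt R X 𝔭₀).toNat ≤ 𝔭₀.asIdeal := Ideal.pow_le_self hk
    rw [hF1, Ideal.one_eq_top, top_le_iff] at hle
    exact hne_top hle
  -- `char X ≤ F 𝔭₀ = (π₀)^k ≤ (π₀ ^ n)`
  calc charIdeal R X = ∏ 𝔭 ∈ t, F 𝔭 := hchar
    _ ≤ t.inf F := Ideal.prod_le_inf
    _ ≤ F 𝔭₀ := Finset.inf_le hmem
    _ = Ideal.span {π₀ ^ (lengthAt R X 𝔭₀).toNat} := by
        simp only [F]; rw [h𝔭₀, Ideal.span_singleton_pow]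
    _ ≤ Ideal.span {π₀ ^ n} := Ideal.span_singleton_le_span_singleton.mpr (pow_dvd_pow π₀ hnk)

/-- **Promotion with a μ-inequality**: `X` f.g. torsion over a Noetherian UFD, `π₀` prime with
`length X_(π₀) ≤ n`; then `A ⊆ (π₀ ^ n)` and `(π₀ ^ m) · A ⊆ char(X)` give `A ⊆ char(X)` (generator of
`char(X)` = `f₀ · f₁`, `f₀ ∣ π₀^n`, `f₁` prime to `π₀`; `n = 0` is `le_charIdeal_of_span_pow_mul_le`).
[cite: NeukirchSchmidtWingberg2008, Ch. V §3, (5.3.9)–(5.3.10)] [cite: Washington1997, §13.2] -/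
theorem le_charIdeal_of_span_pow_mul_le_of_lengthAt_le [Module.Finite R X] (hX : Module.IsTorsion R X)
    {π₀ : R} (hπ₀ : Prime π₀) {n : ℕ}
    (hμ : ∀ 𝔭 : PrimeSpectrum R, 𝔭.asIdeal = Ideal.span {π₀} → lengthAt R X 𝔭 ≤ n)
    {A : Ideal R} (hA : A ≤ Ideal.span {π₀ ^ n}) {m : ℕ}
    (h : Ideal.span {π₀ ^ m} * A ≤ charIdeal R X) :
    A ≤ charIdeal R X := by
  classical
  obtain ⟨t, π, ht, hchar⟩ := exists_charIdeal_eq_span_prod_pow hX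
  -- split the support at the primes equal to `(π₀)`
  set f₀ : R := ∏ 𝔭 ∈ t with 𝔭.asIdeal = Ideal.span {π₀}, π 𝔭 ^ (lengthAt R X 𝔭).toNat with hf₀
  set f₁ : R := ∏ 𝔭 ∈ t with ¬ 𝔭.asIdeal = Ideal.span {π₀}, π 𝔭 ^ (lengthAt R X 𝔭).toNat with hf₁
  have hf : (∏ 𝔭 ∈ t, π 𝔭 ^ (lengthAt R X 𝔭).toNat) = f₀ * f₁ :=
    (Finset.prod_filter_mul_prod_filter_not t (fun 𝔭 => 𝔭.asIdeal = Ideal.span {π₀}) _).symm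
  -- `f₁` is relatively prime to every power of `π₀`
  have hrel : ∀ k : ℕ, IsRelPrime f₁ (π₀ ^ k) := by
    intro k
    refine IsRelPrime.prod_left fun 𝔭 h𝔭 => ?_
    obtain ⟨h𝔭t, hne⟩ := Finset.mem_filter.mp h𝔭
    obtain ⟨-, -, hπ, hπeq⟩ := ht 𝔭 h𝔭t
    refine isRelPrime_pow_of_not_associated hπ hπ₀ (fun hass => hne ?_) _ _
    rw [hπeq]
    exact Ideal.span_singleton_eq_span_singleton.mpr hass
  -- `f₀` divides `π₀ ^ n`: the filtered support is empty or the single point `(π₀)`, of length `≤ n`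
  have hf₀dvd : f₀ ∣ π₀ ^ n := by
    by_cases hempty : (t.filter fun 𝔭 => 𝔭.asIdeal = Ideal.span {π₀}) = ∅
    · rw [hf₀, hempty, Finset.prod_empty]; exact one_dvd _
    · obtain ⟨𝔭₀, h𝔭₀⟩ := Finset.nonempty_iff_ne_empty.mpr hempty
      have h𝔭₀eq : 𝔭₀.asIdeal = Ideal.span {π₀} := (Finset.mem_filter.mp h𝔭₀).2
      have hsingle : (t.filter fun 𝔭 => 𝔭.asIdeal = Ideal.span {π₀}) = {𝔭₀} := by
        refine Finset.eq_singleton_iff_unique_mem.mpr ⟨h𝔭₀, fun 𝔮 h𝔮 => ?_⟩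
        exact PrimeSpectrum.ext (((Finset.mem_filter.mp h𝔮).2).trans h𝔭₀eq.symm)
      rw [hf₀, hsingle, Finset.prod_singleton]
      obtain ⟨-, -, hπ, hπeq⟩ := ht 𝔭₀ (Finset.mem_filter.mp h𝔭₀).1
      have hass : Associated (π 𝔭₀) π₀ :=
        Ideal.span_singleton_eq_span_singleton.mp (hπeq.symm.trans h𝔭₀eq)
      have hlen : (lengthAt R X 𝔭₀).toNat ≤ n := ENat.toNat_le_of_le_coe (hμ 𝔭₀ h𝔭₀eq)
      exact (hass.pow_pow.dvd).trans (pow_dvd_pow π₀ hlen)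
  have hrel₀₁ : IsRelPrime f₁ f₀ := (hrel n).of_dvd_right hf₀dvd
  intro a ha
  have hmem : π₀ ^ m * a ∈ charIdeal R X :=
    h (Ideal.mul_mem_mul (Ideal.mem_span_singleton_self _) ha)
  rw [hchar, Ideal.mem_span_singleton, hf] at hmem
  rw [hchar, Ideal.mem_span_singleton, hf, mul_comm]
  have h₁ : f₁ ∣ a :=
    (hrel m).dvd_of_dvd_mul_left ((dvd_mul_left f₁ f₀).trans hmem)
  have h₀ : f₀ ∣ a := hf₀dvd.trans (Ideal.mem_span_singleton.mp (hA ha))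
  exact hrel₀₁.mul_dvd h₁ h₀

/-- **The sharp μ-part for a square**: `X`, `Y` f.g. torsion over a Noetherian UFD, `π₀` prime,
`length X_(π₀) ≤ 2 · length Y_(π₀)` (`μ(X) ≤ 2 μ(Y)`); then `(π₀ ^ m) · char(Y)² ⊆ char(X)` gives
`char(Y)² ⊆ char(X)` (Howard road: `X = 𝒳_tors`, `Y = 𝔖/ℋ_F`; weaker than `μ(X) = 0`).
[cite: NeukirchSchmidtWingberg2008, Ch. V §3, (5.3.9)–(5.3.10)] [cite: Washington1997, §13.2] -/
theorem sq_charIdeal_le_charIdeal_of_span_pow_mul_le_of_lengthAt_le_two_mul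
    {Y : Type*} [AddCommGroup Y] [_root_.Module R Y] [Module.Finite R X] [Module.Finite R Y]
    (hX : Module.IsTorsion R X) (hY : Module.IsTorsion R Y) {π₀ : R} (hπ₀ : Prime π₀)
    (hμ : ∀ 𝔭 : PrimeSpectrum R, 𝔭.asIdeal = Ideal.span {π₀} →
      lengthAt R X 𝔭 ≤ 2 * lengthAt R Y 𝔭)
    {m : ℕ} (h : Ideal.span {π₀ ^ m} * charIdeal R Y ^ 2 ≤ charIdeal R X) :
    charIdeal R Y ^ 2 ≤ charIdeal R X := by
  classical
  -- the point `(π₀)` of the prime spectrum and the (finite) exponent `ν = length Y_(π₀)`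
  let 𝔭₀ : PrimeSpectrum R := ⟨Ideal.span {π₀}, (Ideal.span_singleton_prime hπ₀.ne_zero).mpr hπ₀⟩
  have h𝔭₀ : 𝔭₀.asIdeal = Ideal.span {π₀} := rfl
  obtain ⟨s, hsann, hs0⟩ := Submodule.annihilator_top_inter_nonZeroDivisors hY
  have hsY : Module.IsTorsionBy R Y s := fun y => Submodule.mem_annihilator.mp hsann y Submodule.mem_top
  have h1 : 𝔭₀.asIdeal.height = 1 := Ideal.height_span_singleton_eq_one_of_mem_nonZeroDivisors
    (mem_nonZeroDivisors_of_ne_zero hπ₀.ne_zero) hπ₀.not_unit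
  set ν : ℕ := (lengthAt R Y 𝔭₀).toNat with hν
  have hνeq : (ν : ℕ∞) = lengthAt R Y 𝔭₀ :=
    ENat.coe_toNat (lengthAt_ne_top_of_isTorsionBy (nonZeroDivisors.ne_zero hs0) hsY 𝔭₀ h1.le)
  -- `char Y ≤ (π₀ ^ ν)`, hence `char Y ^ 2 ≤ (π₀ ^ (2ν))`
  have hI : charIdeal R Y ≤ Ideal.span {π₀ ^ ν} :=
    charIdeal_le_span_singleton_pow_of_le_lengthAt hY hπ₀ 𝔭₀ h𝔭₀ hνeq.le
  have hI2 : charIdeal R Y ^ 2 ≤ Ideal.span {π₀ ^ (2 * ν)} := by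
    calc charIdeal R Y ^ 2 ≤ Ideal.span {π₀ ^ ν} ^ 2 := Ideal.pow_right_mono hI 2
      _ = Ideal.span {π₀ ^ (2 * ν)} := by rw [Ideal.span_singleton_pow, ← pow_mul, mul_comm]
  -- `length X_(π₀) ≤ 2ν`
  have hμ' : ∀ 𝔭 : PrimeSpectrum R, 𝔭.asIdeal = Ideal.span {π₀} → lengthAt R X 𝔭 ≤ (2 * ν : ℕ) := by
    intro 𝔭 h𝔭
    have h𝔭eq : 𝔭 = 𝔭₀ := PrimeSpectrum.ext (h𝔭.trans h𝔭₀.symm)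
    subst h𝔭eq
    calc lengthAt R X 𝔭₀ ≤ 2 * lengthAt R Y 𝔭₀ := hμ 𝔭₀ h𝔭₀
      _ = ((2 * ν : ℕ) : ℕ∞) := by rw [← hνeq]; push_cast; ring
  exact le_charIdeal_of_span_pow_mul_le_of_lengthAt_le hX hπ₀ hμ' hI2 h

end Promotion

end Module

/-! ### The case `R = Λ = ℤ_[p]⟦T⟧`: `μ = 0` (and no `(T)`-part) promotes the localized containment -/

namespace IwasawaAlgebra

variable {p : ℕ} [Fact p.Prime] {X : Type*} [AddCommGroup X] [_root_.Module (IwasawaAlgebra p) X]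

/-- `p`, as an element of `Λ = ℤ_[p]⟦T⟧` (the natural-number cast, which is the constant power series
`C p`), is a prime element (`Λ/(p) ≅ 𝔽_p⟦T⟧`; Washington §13.1). [cite: Washington1997, §13.1] -/
theorem prime_natCast : Prime (p : IwasawaAlgebra p) := by
  have h := prime_C p
  rwa [map_natCast] at h

/-- **`μ(X) = 0` promotes `(p^m)·A ⊆ char_Λ(X)` to `A ⊆ char_Λ(X)`** for a finitely generated torsion
`Λ`-module `X` whose local length at the height-one prime `(p)` vanishes (its `μ`-invariant; the
hypothesis is stated as that local length to stay free of the `toNat` junk of `muInvariant`).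
Washington §13.2. [cite: Washington1997, §13.2] -/
theorem le_charIdeal_of_span_p_pow_mul_le [Module.Finite (IwasawaAlgebra p) X]
    (hX : Module.IsTorsion (IwasawaAlgebra p) X)
    (hμ : ∀ 𝔭 : PrimeSpectrum (IwasawaAlgebra p), 𝔭.asIdeal = Ideal.span {(p : IwasawaAlgebra p)} →
      Module.lengthAt (IwasawaAlgebra p) X 𝔭 = 0)
    {A : Ideal (IwasawaAlgebra p)} {m : ℕ}
    (h : Ideal.span {(p : IwasawaAlgebra p) ^ m} * A ≤ Module.charIdeal (IwasawaAlgebra p) X) :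
    A ≤ Module.charIdeal (IwasawaAlgebra p) X :=
  Module.le_charIdeal_of_span_pow_mul_le hX prime_natCast hμ h

/-- **`μ(X) = 0` and no `(T)`-primary part promote `(p^m)(T^n)·A ⊆ char_Λ(X)` to `A ⊆ char_Λ(X)`** —
the literal shape `Ideal.span {(p : Λ) ^ m} * Ideal.span {PowerSeries.X ^ n} * A` of the localized
Howard containments in the tree (`CastellaGrossiLeeSkinner2022.charIdeal_torsion_dvd_localized_of_thm413`
read through `Ideal.le_of_dvd`). Washington §13.2. [cite: Washington1997, §13.2] -/
theorem le_charIdeal_of_span_p_pow_mul_span_X_pow_mul_le [Module.Finite (IwasawaAlgebra p) X]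
    (hX : Module.IsTorsion (IwasawaAlgebra p) X)
    (hμ : ∀ 𝔭 : PrimeSpectrum (IwasawaAlgebra p), 𝔭.asIdeal = Ideal.span {(p : IwasawaAlgebra p)} →
      Module.lengthAt (IwasawaAlgebra p) X 𝔭 = 0)
    (hT : ∀ 𝔭 : PrimeSpectrum (IwasawaAlgebra p),
      𝔭.asIdeal = Ideal.span {(PowerSeries.X : IwasawaAlgebra p)} →
      Module.lengthAt (IwasawaAlgebra p) X 𝔭 = 0)
    {A : Ideal (IwasawaAlgebra p)} {m n : ℕ}
    (h : Ideal.span {(p : IwasawaAlgebra p) ^ m} * Ideal.span {(PowerSeries.X : IwasawaAlgebra p) ^ n} *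
      A ≤ Module.charIdeal (IwasawaAlgebra p) X) :
    A ≤ Module.charIdeal (IwasawaAlgebra p) X :=
  Module.le_charIdeal_of_span_pow_mul_span_pow_mul_le hX prime_natCast PowerSeries.X_prime hμ hT h

/-- The same with ONE generator `(p ^ m * T ^ n)` (the shape of the lines' `stub_depthPos_localized…`).
Washington §13.2. [cite: Washington1997, §13.2] -/
theorem le_charIdeal_of_span_p_pow_mul_X_pow_mul_le [Module.Finite (IwasawaAlgebra p) X]
    (hX : Module.IsTorsion (IwasawaAlgebra p) X)
    (hμ : ∀ 𝔭 : PrimeSpectrum (IwasawaAlgebra p), 𝔭.asIdeal = Ideal.span {(p : IwasawaAlgebra p)} →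
      Module.lengthAt (IwasawaAlgebra p) X 𝔭 = 0)
    (hT : ∀ 𝔭 : PrimeSpectrum (IwasawaAlgebra p),
      𝔭.asIdeal = Ideal.span {(PowerSeries.X : IwasawaAlgebra p)} →
      Module.lengthAt (IwasawaAlgebra p) X 𝔭 = 0)
    {A : Ideal (IwasawaAlgebra p)} {m n : ℕ}
    (h : Ideal.span {(p : IwasawaAlgebra p) ^ m * (PowerSeries.X : IwasawaAlgebra p) ^ n} * A ≤
      Module.charIdeal (IwasawaAlgebra p) X) :
    A ≤ Module.charIdeal (IwasawaAlgebra p) X :=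
  Module.le_charIdeal_of_span_pow_mul_pow_mul_le hX prime_natCast PowerSeries.X_prime hμ hT h

/-- **Promotion with a μ-inequality over `Λ`**: `length X_(p) ≤ n`, `A ⊆ (p ^ n)`, `(p^m)·A ⊆ char_Λ(X)`
give `A ⊆ char_Λ(X)` (`n = 0`: `le_charIdeal_of_span_p_pow_mul_le`). [cite: Washington1997, §13.2] -/
theorem le_charIdeal_of_span_p_pow_mul_le_of_lengthAt_le [Module.Finite (IwasawaAlgebra p) X]
    (hX : Module.IsTorsion (IwasawaAlgebra p) X) {n : ℕ}
    (hμ : ∀ 𝔭 : PrimeSpectrum (IwasawaAlgebra p), 𝔭.asIdeal = Ideal.span {(p : IwasawaAlgebra p)} →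
      Module.lengthAt (IwasawaAlgebra p) X 𝔭 ≤ n)
    {A : Ideal (IwasawaAlgebra p)} (hA : A ≤ Ideal.span {(p : IwasawaAlgebra p) ^ n}) {m : ℕ}
    (h : Ideal.span {(p : IwasawaAlgebra p) ^ m} * A ≤ Module.charIdeal (IwasawaAlgebra p) X) :
    A ≤ Module.charIdeal (IwasawaAlgebra p) X :=
  Module.le_charIdeal_of_span_pow_mul_le_of_lengthAt_le hX prime_natCast hμ hA h

/-- **The sharp μ-part of the Howard road over `Λ`**: f.g. torsion `X` (`𝒳_tors`), `Y` (`𝔖/ℋ_F`) with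
`length X_(p) ≤ 2 · length Y_(p)` (`μ(X) ≤ 2 μ(Y)`): `(p^m) · char_Λ(Y)² ⊆ char_Λ(X)` promotes to
`char_Λ(Y)² ⊆ char_Λ(X)` (weaker input than `μ(X) = 0`). [cite: Washington1997, §13.2] -/
theorem sq_charIdeal_le_charIdeal_of_span_p_pow_mul_le_of_lengthAt_le_two_mul
    {Y : Type*} [AddCommGroup Y] [_root_.Module (IwasawaAlgebra p) Y]
    [Module.Finite (IwasawaAlgebra p) X] [Module.Finite (IwasawaAlgebra p) Y]
    (hX : Module.IsTorsion (IwasawaAlgebra p) X) (hY : Module.IsTorsion (IwasawaAlgebra p) Y)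
    (hμ : ∀ 𝔭 : PrimeSpectrum (IwasawaAlgebra p), 𝔭.asIdeal = Ideal.span {(p : IwasawaAlgebra p)} →
      Module.lengthAt (IwasawaAlgebra p) X 𝔭 ≤ 2 * Module.lengthAt (IwasawaAlgebra p) Y 𝔭)
    {m : ℕ} (h : Ideal.span {(p : IwasawaAlgebra p) ^ m} * Module.charIdeal (IwasawaAlgebra p) Y ^ 2 ≤
      Module.charIdeal (IwasawaAlgebra p) X) :
    Module.charIdeal (IwasawaAlgebra p) Y ^ 2 ≤ Module.charIdeal (IwasawaAlgebra p) X :=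
  Module.sq_charIdeal_le_charIdeal_of_span_pow_mul_le_of_lengthAt_le_two_mul hX hY prime_natCast hμ h

end IwasawaAlgebra

end Literature.NumberTheory.EllipticCurves

end
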